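import Literature.Probability.LatticeModels.PointwiseScalingLimitScale
import Literature.Probability.LatticeModels.PointwiseScalingLimitTwoPointMono
import HarnessLib

/-!
# Self-similarity of pointwise scaling limits; non-degeneracy from ONE positive pair

Topic `Probability/LatticeModels`; family `crit-ising`. THEOREM-ONLY leaf file (no definitions, no
named facts) about the prelude notion `HasPointwiseScalingLimit G ρ S` (`ScalingLimit.lean`).

* `HasPointwiseScalingLimit.comp_smul` — **rescaling the continuum variable gives another pointwise
  limit of the SAME lattice family**: if `ρ(δ)ⁿ G([x/δ]) → S` (full filter `δ → 0⁺`, locally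
  uniformly on non-coincident configurations) then, for every `c > 0`, `x ↦ S n (c·x)` is the pointwise
  limit with renormalisation `δ ↦ ρ(cδ)` (`[c xᵢ/(c δ)] = [xᵢ/δ]` exactly, coordinatewise floor).
  This is the formal content of "a full-filter scaling limit is self-similar".
* `HasPointwiseScalingLimit.isNondegenerateTwoPoint_of_two_pos` — for the critical Ising correlators
  `criticalCorr d` (`d ≥ 1`, `ρ > 0` on `(0,1]`): a pointwise limit whose two-point function is
  positive at ONE non-coincident pair is positive at EVERY non-coincident pair
  (`IsNondegenerateTwoPoint`). Inward, positivity propagates by the Messager–Miracle-Solé comparison in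
  the limit (`two_pos_of_mul_norm_lt`); OUTWARD — where no two-point doubling bound is known on `ℤ³` —
  it propagates through self-similarity: `S` and its contraction `x ↦ S(μx)` are two limits of the same
  family, positive at the common pair `x₀`, hence proportional (`exists_scale`, `S(μx) = c² S(x)`), and
  `S(μy) > 0` for `μ` small by the inward step.

Consequence for the conformal-limit problem on `ℤ³`: in clause (i) (`IsNondegenerateTwoPoint`) of
`CritIsing3DConformalLimit` / crux `IsingEuclidUpgradeR4NonGaussian`, "positive at one pair" and
"positive everywhere" are the same hypothesis.

## References

* A. Messager, S. Miracle-Solé, J. Stat. Phys. 17 (1977) 245–262 [MessagerMiracleSoleJSP1977].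
* D. Chelkak, C. Hongler, K. Izyurov, Ann. Math. 181 (2015), Thm 1.1 (shape of the notion)
  [ChelkakHonglerIzyurov2015].
-/

noncomputable section

open Filter Topology Set

namespace Literature.Probability.LatticeModels

variable {d : ℕ}

/-- `[c·p/(c·δ)] = [p/δ]` coordinatewise (`c ≠ 0`). [folklore] -/
theorem latticeApprox_smul {c : ℝ} (hc : c ≠ 0) (δ : ℝ) (p : EuclideanSpace ℝ (Fin d)) :
    latticeApprox (c * δ) (c • p) = latticeApprox δ p := by
  funext k
  simp only [latticeApprox_apply, PiLp.smul_apply, smul_eq_mul, mul_div_mul_left _ _ hc]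

/-- The rescaled correlator for the renormalisation `δ ↦ ρ(cδ)` at `x` is the original one at mesh
`cδ` and configuration `c·x`. [folklore] -/
theorem rescaledCorrelator_comp_smul (G : LatticeCorrFamily d) (ρ : ℝ → ℝ) {c : ℝ} (hc : c ≠ 0)
    (n : ℕ) (δ : ℝ) (x : Fin n → EuclideanSpace ℝ (Fin d)) :
    rescaledCorrelator G (fun δ => ρ (c * δ)) n δ x =
      rescaledCorrelator G ρ n (c * δ) (fun i => c • x i) := by
  simp only [rescaledCorrelator_apply, latticeApprox_smul hc]

/-- Scaling a configuration by `c ≠ 0` preserves non-coincidence. [folklore] -/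
theorem smul_mem_nonCoincident {n : ℕ} {c : ℝ} (hc : c ≠ 0) {x : Fin n → EuclideanSpace ℝ (Fin d)}
    (hx : x ∈ NonCoincident d n) : (fun i => c • x i) ∈ NonCoincident d n :=
  (smul_right_injective (EuclideanSpace ℝ (Fin d)) hc).comp hx

/-- **Self-similarity of pointwise scaling limits.** If `S` is the pointwise scaling limit of `G` with
renormalisation `ρ`, then for every `c > 0` the family `x ↦ S n (c·x)` is the pointwise scaling limit
of the SAME `G` with renormalisation `δ ↦ ρ(cδ)`. [folklore] -/
theorem HasPointwiseScalingLimit.comp_smul {G : LatticeCorrFamily d} {ρ : ℝ → ℝ} {S : CorrFamily d}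
    (h : HasPointwiseScalingLimit G ρ S) {c : ℝ} (hc : 0 < c) :
    HasPointwiseScalingLimit G (fun δ => ρ (c * δ)) (fun n x => S n (fun i => c • x i)) := by
  intro n
  have hsc : Continuous fun x : Fin n → EuclideanSpace ℝ (Fin d) => (fun i => c • x i) :=
    continuous_pi fun i => (continuous_apply i).const_smul c
  rw [tendstoLocallyUniformlyOn_iff_forall_isCompact (isOpen_nonCoincident d n)]
  intro K hK hKc
  have hK' : (fun x : Fin n → EuclideanSpace ℝ (Fin d) => (fun i => c • x i)) '' K ⊆ NonCoincident d n := by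
    rintro _ ⟨x, hx, rfl⟩
    exact smul_mem_nonCoincident hc.ne' (hK hx)
  have hu : TendstoUniformlyOn (rescaledCorrelator G ρ n) (S n) (𝓝[>] 0)
      ((fun x : Fin n → EuclideanSpace ℝ (Fin d) => (fun i => c • x i)) '' K) :=
    (tendstoLocallyUniformlyOn_iff_forall_isCompact (isOpen_nonCoincident d n)).1 (h n) _ hK'
      (hKc.image hsc)
  -- multiplication by `c > 0` maps `δ → 0⁺` to itself
  -- (cf. `Literature.MathematicalPhysics.QuantumFieldTheory.tendsto_const_mul_nhdsGT_zero`)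
  have hmul : Tendsto (fun δ : ℝ => c * δ) (𝓝[>] 0) (𝓝[>] 0) := by
    refine tendsto_nhdsWithin_iff.2 ⟨?_, eventually_mem_nhdsWithin.mono fun δ hδ => mul_pos hc hδ⟩
    have h0 : Tendsto (fun δ : ℝ => c * δ) (𝓝 0) (𝓝 (c * 0)) := tendsto_id.const_mul c
    rw [mul_zero] at h0
    exact h0.mono_left nhdsWithin_le_nhds
  rw [Metric.tendstoUniformlyOn_iff] at hu ⊢
  intro ε hε
  filter_upwards [hmul.eventually (hu ε hε)] with δ hδ x hx
  rw [rescaledCorrelator_comp_smul G ρ hc.ne']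
  exact hδ _ (mem_image_of_mem _ hx)

/-- The sup-distance of a pair scales: `‖(μx)₀ - (μx)₁‖ = μ‖x₀ - x₁‖` for `μ ≥ 0`. [folklore] -/
theorem norm_ofLp_smul_sub {μ : ℝ} (hμ : 0 ≤ μ) (p q : EuclideanSpace ℝ (Fin d)) :
    ‖WithLp.ofLp (μ • p) - WithLp.ofLp (μ • q)‖ = μ * ‖WithLp.ofLp p - WithLp.ofLp q‖ := by
  rw [WithLp.ofLp_smul, WithLp.ofLp_smul, ← smul_sub, norm_smul, Real.norm_eq_abs, abs_of_nonneg hμ]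

/-- **Non-degeneracy from one positive pair** (critical Ising correlators on `ℤ^d`, `d ≥ 1`): a
pointwise scaling limit (`ρ > 0` on `(0,1]`) with `S₂(x₀) > 0` at ONE non-coincident pair has
`S₂ > 0` at every non-coincident pair. Inward: MMS in the limit (`two_pos_of_mul_norm_lt`). Outward:
the contraction `x ↦ S(μx)` (`μ ∈ (0,1)`, renormalisation `ρ(μδ) > 0` on `(0,1]`) is a limit of the
same family (`comp_smul`), positive at `x₀` too, so `S(μ·) = c²S(·)` on pairs (`exists_scale`) and
`S₂(y) = c⁻²S₂(μy) > 0` once `dμ‖y₀-y₁‖ < ‖x₀,₀-x₀,₁‖`. [cite: MessagerMiracleSoleJSP1977, Theorem (monotonicity)] -/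
theorem HasPointwiseScalingLimit.isNondegenerateTwoPoint_of_two_pos (hd : 1 ≤ d) {ρ : ℝ → ℝ}
    {S : CorrFamily d} (hρ : ∀ δ ∈ Set.Ioc (0:ℝ) 1, 0 < ρ δ)
    (hlim : HasPointwiseScalingLimit (criticalCorr d) ρ S)
    {x₀ : Fin 2 → EuclideanSpace ℝ (Fin d)} (hx₀ : x₀ ∈ NonCoincident d 2) (hpos : 0 < S 2 x₀) :
    IsNondegenerateTwoPoint S := by
  intro y hy
  have hinj₀ : Function.Injective x₀ := hx₀
  set r₀ : ℝ := ‖WithLp.ofLp (x₀ 0) - WithLp.ofLp (x₀ 1)‖ with hr₀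
  set R : ℝ := ‖WithLp.ofLp (y 0) - WithLp.ofLp (y 1)‖ with hR
  have hr₀pos : 0 < r₀ := by
    rw [hr₀, norm_pos_iff, sub_ne_zero]
    intro h
    exact absurd (hinj₀ ((WithLp.ofLp_injective 2) h)) (by decide)
  have hR0 : 0 ≤ R := norm_nonneg _
  have hd0 : (0:ℝ) < d := by exact_mod_cast hd
  -- inward positivity from `x₀`
  have inward : ∀ x ∈ NonCoincident d 2,
      (d:ℝ) * ‖WithLp.ofLp (x 0) - WithLp.ofLp (x 1)‖ < r₀ → 0 < S 2 x :=
    fun x hx hfar => hlim.two_pos_of_mul_norm_lt hd hx hx₀ hfar hpos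
  -- the contraction factor
  set μ : ℝ := r₀ / (d * R + d * r₀ + r₀) with hμ
  have hden : 0 < (d:ℝ) * R + d * r₀ + r₀ := by positivity
  have hμ0 : 0 < μ := div_pos hr₀pos hden
  have hμ1 : μ ≤ 1 := by
    rw [hμ, div_le_one hden]
    nlinarith
  have hμR : (d:ℝ) * (μ * R) < r₀ := by
    have : (d:ℝ) * (μ * R) = r₀ * (d * R) / (d * R + d * r₀ + r₀) := by rw [hμ]; ring
    rw [this, div_lt_iff₀ hden]
    nlinarith [mul_pos hd0 (mul_pos hr₀pos hr₀pos), mul_pos hr₀pos hr₀pos]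
  have hμr : (d:ℝ) * (μ * r₀) < r₀ := by
    have : (d:ℝ) * (μ * r₀) = r₀ * (d * r₀) / (d * R + d * r₀ + r₀) := by rw [hμ]; ring
    rw [this, div_lt_iff₀ hden]
    nlinarith [mul_nonneg (mul_nonneg hr₀pos.le hd0.le) hR0, mul_pos hr₀pos hr₀pos]
  -- the contracted limit, its renormalisation is positive on `(0,1]`
  have hlimμ := hlim.comp_smul hμ0
  have hρμ : ∀ δ ∈ Set.Ioc (0:ℝ) 1, 0 < ρ (μ * δ) := fun δ hδ =>
    hρ _ ⟨mul_pos hμ0 hδ.1, mul_le_one₀ hμ1 hδ.1.le hδ.2⟩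
  -- both limits are positive at `x₀`
  have hposμ : 0 < S 2 (fun i => μ • x₀ i) := by
    refine inward _ (smul_mem_nonCoincident hμ0.ne' hx₀) ?_
    rw [norm_ofLp_smul_sub hμ0.le]
    exact hμr
  obtain ⟨c, hc, hscale⟩ := hlim.exists_scale hρ hρμ hlimμ hx₀ hpos hposμ
  -- `S₂(μ y) = c² S₂(y)` and `S₂(μ y) > 0`
  have hy' : 0 < S 2 (fun i => μ • y i) := by
    refine inward _ (smul_mem_nonCoincident hμ0.ne' hy) ?_
    rw [norm_ofLp_smul_sub hμ0.le]
    exact hμR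
  have heq : S 2 (fun i => μ • y i) = c ^ 2 * S 2 y := hscale 2 y hy
  rw [heq] at hy'
  exact pos_of_mul_pos_right hy' (pow_pos hc 2).le

end Literature.Probability.LatticeModels

end
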